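import Summits.BirchSwinnertonDyer.Rank1Residual.GaloisImage.MultiplicativeLocalTorsion
import Summits.BirchSwinnertonDyer.Rank1Residual.Visibility.RankOnePairs1
import Summits.BirchSwinnertonDyer.Rank1Residual.Visibility.RankOnePairs2
import Summits.BirchSwinnertonDyer.Rank1Residual.Visibility.RankOnePairs3
import Summits.BirchSwinnertonDyer.Rank1Residual.Visibility.RankOnePairs4
import Summits.BirchSwinnertonDyer.Rank1Residual.Visibility.RankOnePairs5
import Summits.BirchSwinnertonDyer.Rank1Residual.Visibility.RankOnePairs6
import Summits.BirchSwinnertonDyer.Rank1Residual.Visibility.RankOnePairs7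
import Summits.BirchSwinnertonDyer.Rank1Residual.Visibility.RankOnePairs8
import HarnessLib
/-!
# BSD rank-≤1 residual cell: rank-one VISIBILITY certificates at `p = 3` with multiplicative partner —
# the local binder `E'(ℚ_3)[3] = 0` PROVED in the kernel (gen 8), file 1 of 3: `104907a1`, `104907e1`, `134832t1`, `161376m1`

HONEST FRAMING (cell `b2b-bsdres-*`, run/shared/lean/b2b/bsd-rank1-residual/, verbatim): the goal
of the cell is to DELETE the COMBINATION-SHAPED residual classes for ALL analytic-rank `≤ 1` elliptic
curves over `ℚ` — "full BSD formula for every rank `≤ 1` curve in class C" assembled STRICTLY from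
published theorems — so that the rank-`≤ 1` remainder becomes exactly the CONSTRUCTION-SHAPED
classes, which are TYPED (missing-input Props), NOT attempted; this is not "finishing BSD".
Prove what is provable now; shrink each hard class to its core with data; no claim beyond stated
classes. Unit `b2b-bsdres-x11c` (gen 8). Theorems only (no definition, no named fact). PER PAIR (a
certificate shape), not a class theorem; class X11b stays as labelled; the lane certifies pairs and
owns verdicts; nothing is booked by this file.

## What this file does

Of the 30 gen-6 survivor classes of the rank-one visibility lever (`Visibility/RankOnePairs{1..8}`,
theorems `bsdp_v<label>`), the 11 X11b classes `104907a1`, `104907e1`, `134832t1`, `161376m1`,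
`171735n1`, `315861g1`, `317400y1`, `338919c1`, `380649a1`, `382458b1`, `388032bj1` have a rank-3
partner `E'` with `3 ∥ N_{E'}` and `ord_3 Δ_min(E') ∈ {2, 4, 7}` (data
`b2b-bsdres-x11c/gen6/pairs.json`).  For them the local binder `E'(ℚ_3)[3] = 0` of
`X11b.bsdp_of_kolyvagin_of_congr` — a numerically certified HYPOTHESIS in gen 6 (hyp ENGINE V bit
`H_loc`, two engines) — is a KERNEL THEOREM by gen 8's
`GaloisImage.natCard_ker_nsmul_adicCompletion_eq_one_of_mult_of_not_dvd_padicValRat_j`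
(`E[3]^{I_3} = 0` at a multiplicative `3` with `3 ∤ ord_3 Δ_min`: Serre 1972 §1.12, valuation half
of the Kummer criterion).  Three files re-instantiate the 11 certificates (this file: 104907a1, 104907e1, 134832t1, 161376m1) through
`X11b.bsdp_of_kolyvagin_of_congr_of_primeList_of_mult` (`GaloisImage/MultiplicativeLocalTorsion.lean`):
theorems `bsdp_v<label>_of_mult` with `hloc` asked only at the primes of `S` OTHER than `3`.
KERNEL per pair, in addition to gen 6's items: global minimality of the partner's Cremona model
(bounded Kraus criterion, `decide`), `Mult E' 3` (`3 ∣ Δ`, `3 ∤ c₄`), `ord_3 Δ(E') = e` (`3ᵉ ∣ Δ`,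
`3ᵉ⁺¹ ∤ Δ`), `3 ∤ e`.  BINDERS left to the lane: as in gen 6 minus the `v = 3` local condition.

References: [CremonaMazur2000] §3; [AgasheStein2002] Thm. 3.1; [McCallumLMS1991] §1;
[SerreInventiones1972] §1.12; [SilvermanAEC2009] VII.1, VII.5.1; [Cremona2006].
-/

set_option autoImplicit false

noncomputable section

open scoped Classical

open WeierstrassCurve Literature.NumberTheory.EllipticCurves
  Literature.NumberTheory.EllipticCurves.Rank1Residual
  Literature.NumberTheory.EllipticCurves.Rank1Residual.Typed
  Literature.NumberTheory.EllipticCurves.Rank1Residual.X11RankOneCertificates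
  Summit.BirchSwinnertonDyer.BirchSwinnertonDyer.Rank1Residual.IntModel
  Summit.BirchSwinnertonDyer.BirchSwinnertonDyer.Rank1Residual.X11RankOne
  Summit.BirchSwinnertonDyer.Rank1Residual.GaloisImage
open NumberField IsDedekindDomain

namespace Summit.BirchSwinnertonDyer.Rank1Residual.Visibility

/-- **`104907a1 @ 3` — the visibility certificate of `bsdp_v104907a1` (gen 6) with the local binder at
`v = 3` PROVED**: `hloc` is asked only at the primes of `S` other than `3`; at `3` the partner
`104907f1` has multiplicative reduction with `ord_3 Δ_min = 2` (`3 ∤ 2`), so `E'(ℚ_3)[3] = 0`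
is the kernel theorem `natCard_ker_nsmul_adicCompletion_eq_one_of_mult_of_not_dvd_padicValRat_j`
(gen 8; partner globally minimal by the bounded Kraus criterion, multiplicative at `3` from
`3 ∣ Δ`, `3 ∤ c₄`). All other binders and their two-engine evidence exactly as in `bsdp_v104907a1`.
Per pair; nothing booked. [cite: McCallumLMS1991, §1 Theorem (Kolyvagin), p. 296]
[cite: CremonaMazur2000, §3 and Table 1] [cite: SerreInventiones1972, §1.12 (Cor. of Prop. 13)] -/
theorem bsdp_v104907a1_of_mult (hCT : exists_casselsTate_pairing (K := ℚ))
    (hGZK : rank_eq_analyticRank_of_analyticRank_le_one)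
    (W : WeierstrassCurve ℚ) (hW : W = ⟨1, 1, 0, -4127070, -1079605809⟩)
    {N : ℕ} [NeZero N] {K : Type} [Field K] [NumberField K] (hKo : kolyvagin N W K)
    (hB : Kolyvagin1990_padicValNat_card_sha_le N W K) (hK : IsImaginaryQuadratic K)
    (hH : SatisfiesHeegnerHypothesis N K) {P : (W.baseChange K).toAffine.Point}
    (hP : IsHeegnerPoint N W K P) (hnt : ¬ IsOfFinAddOrder P)
    (hI : padicValNat 3 (AddSubgroup.zmultiples P).index ≤ 1)
    (hr : W.analyticRank = 1) {s : ℚ} (hs : shaAn W = (s : ℂ)) (hv : padicValRat 3 s = 2)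
    (W' : WeierstrassCurve ℚ) (hW' : W' = ⟨0, -1, 1, -62, 230⟩)
    (θ : geomTorsion W' (3 : ℕ) ≃+ geomTorsion W (3 : ℕ))
    (hθ : ∀ (σ : Field.absoluteGaloisGroup ℚ) (Q : geomTorsion W' (3 : ℕ)), θ (σ • Q) = σ • θ Q)
    (hrank : 3 ≤ W'.mordellWeilRank)
    (hloc : ∀ v : HeightOneSpectrum (𝓞 ℚ), (Rat.HeightOneSpectrum.primesEquiv v : ℕ) ∈ [3, 11, 17] →
      (Rat.HeightOneSpectrum.primesEquiv v : ℕ) ≠ 3 →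
      Nat.card (nsmulAddMonoidHom 3 :
        (W'.baseChange (v.adicCompletion ℚ)).toAffine.Point →+ _).ker = 1) :
    BSDp W 3 := by
  subst hW hW'
  haveI hE : (⟨1, 1, 0, -4127070, -1079605809⟩ : WeierstrassCurve ℚ).IsElliptic :=
    X11b.isElliptic_of_discOf_ne_zero 1 1 0 (-4127070) (-1079605809) (by decide +kernel)
  haveI hE' : (⟨0, -1, 1, -62, 230⟩ : WeierstrassCurve ℚ).IsElliptic :=
    X11b.isElliptic_of_discOf_ne_zero 0 (-1) 1 (-62) 230 (by decide +kernel)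
  haveI hM : (⟨1, 1, 0, -4127070, -1079605809⟩ : WeierstrassCurve ℚ).IsGloballyMinimal :=
    isGloballyMinimal_of_krausCriterion_bounded 1 1 0 (-4127070) (-1079605809)
      (by decide +kernel) (by decide +kernel) (by decide +kernel)
  haveI : Fact (Nat.Prime 3) := ⟨by norm_num⟩
  have hρ : Surj (⟨1, 1, 0, -4127070, -1079605809⟩ : WeierstrassCurve ℚ) 3 :=
    surj3_v104907a1 (integralModelInt_eq_of_map_eq _ (map_mk_int 1 1 0 (-4127070) (-1079605809)))
  haveI hM' : (⟨0, -1, 1, -62, 230⟩ : WeierstrassCurve ℚ).IsGloballyMinimal :=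
    isGloballyMinimal_of_krausCriterion_bounded 0 (-1) 1 (-62) 230
      (by decide +kernel) (by decide +kernel) (by decide +kernel)
  have hI' : integralModelInt (⟨0, -1, 1, -62, 230⟩ : WeierstrassCurve ℚ) = (⟨0, -1, 1, -62, 230⟩ : WeierstrassCurve ℤ) :=
    integralModelInt_eq_of_map_eq _ (map_mk_int 0 (-1) 1 (-62) 230)
  have hmult' : Mult (⟨0, -1, 1, -62, 230⟩ : WeierstrassCurve ℚ) 3 :=
    hasMultiplicativeReductionAtPrime_of_intModel hI' 3 (by rw [intCurve_Δ]; decide +kernel)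
      (by rw [intCurve_c₄]; decide +kernel)
  have hj' : ¬ ((3 : ℕ) : ℤ) ∣ padicValRat 3 (⟨0, -1, 1, -62, 230⟩ : WeierstrassCurve ℚ).j := by
    rw [← AdditivePotMult.dvd_padicValInt_minimalDiscriminantInt_iff_of_mult _ 3 hmult' 3,
      minimalDiscriminantInt_eq hI', padicValInt_eq_of_dvd_of_not_dvd 3 (e := 2)
        (by rw [intCurve_Δ]; decide +kernel) (by rw [intCurve_Δ]; decide +kernel)]
    decide
  exact X11b.bsdp_of_kolyvagin_of_congr_of_primeList_of_mult _ 3 hCT hGZK hKo hB hK hH hP hnt (by norm_num) hρ hI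
    hr hs hv _ θ hθ hrank (map_mk_int 1 1 0 (-4127070) (-1079605809)) (map_mk_int 0 (-1) 1 (-62) 230)
    [3, 11, 17] (by decide)
    (X11b.forall_mem_of_natAbs_eq_prod_pow [3, 11, 17] [5, 9, 8] (by intro q hq; fin_cases hq <;> norm_num)
      (by rw [intCurve_Δ]; decide +kernel))
    (X11b.forall_mem_of_natAbs_eq_prod_pow [3, 11, 17] [2, 3, 2] (by intro q hq; fin_cases hq <;> norm_num)
      (by rw [intCurve_Δ]; decide +kernel))
    hmult' hj' hloc


/-- **`104907e1 @ 3` — the visibility certificate of `bsdp_v104907e1` (gen 6) with the local binder at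
`v = 3` PROVED**: `hloc` is asked only at the primes of `S` other than `3`; at `3` the partner
`104907f1` has multiplicative reduction with `ord_3 Δ_min = 2` (`3 ∤ 2`), so `E'(ℚ_3)[3] = 0`
is the kernel theorem `natCard_ker_nsmul_adicCompletion_eq_one_of_mult_of_not_dvd_padicValRat_j`
(gen 8; partner globally minimal by the bounded Kraus criterion, multiplicative at `3` from
`3 ∣ Δ`, `3 ∤ c₄`). All other binders and their two-engine evidence exactly as in `bsdp_v104907e1`.
Per pair; nothing booked. [cite: McCallumLMS1991, §1 Theorem (Kolyvagin), p. 296]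
[cite: CremonaMazur2000, §3 and Table 1] [cite: SerreInventiones1972, §1.12 (Cor. of Prop. 13)] -/
theorem bsdp_v104907e1_of_mult (hCT : exists_casselsTate_pairing (K := ℚ))
    (hGZK : rank_eq_analyticRank_of_analyticRank_le_one)
    (W : WeierstrassCurve ℚ) (hW : W = ⟨0, -1, 1, -3075605144, -65650380044998⟩)
    {N : ℕ} [NeZero N] {K : Type} [Field K] [NumberField K] (hKo : kolyvagin N W K)
    (hB : Kolyvagin1990_padicValNat_card_sha_le N W K) (hK : IsImaginaryQuadratic K)
    (hH : SatisfiesHeegnerHypothesis N K) {P : (W.baseChange K).toAffine.Point}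
    (hP : IsHeegnerPoint N W K P) (hnt : ¬ IsOfFinAddOrder P)
    (hI : padicValNat 3 (AddSubgroup.zmultiples P).index ≤ 1)
    (hr : W.analyticRank = 1) {s : ℚ} (hs : shaAn W = (s : ℂ)) (hv : padicValRat 3 s = 2)
    (W' : WeierstrassCurve ℚ) (hW' : W' = ⟨0, -1, 1, -62, 230⟩)
    (θ : geomTorsion W' (3 : ℕ) ≃+ geomTorsion W (3 : ℕ))
    (hθ : ∀ (σ : Field.absoluteGaloisGroup ℚ) (Q : geomTorsion W' (3 : ℕ)), θ (σ • Q) = σ • θ Q)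
    (hrank : 3 ≤ W'.mordellWeilRank)
    (hloc : ∀ v : HeightOneSpectrum (𝓞 ℚ), (Rat.HeightOneSpectrum.primesEquiv v : ℕ) ∈ [3, 11, 17] →
      (Rat.HeightOneSpectrum.primesEquiv v : ℕ) ≠ 3 →
      Nat.card (nsmulAddMonoidHom 3 :
        (W'.baseChange (v.adicCompletion ℚ)).toAffine.Point →+ _).ker = 1) :
    BSDp W 3 := by
  subst hW hW'
  haveI hE : (⟨0, -1, 1, -3075605144, -65650380044998⟩ : WeierstrassCurve ℚ).IsElliptic :=
    X11b.isElliptic_of_discOf_ne_zero 0 (-1) 1 (-3075605144) (-65650380044998) (by decide +kernel)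
  haveI hE' : (⟨0, -1, 1, -62, 230⟩ : WeierstrassCurve ℚ).IsElliptic :=
    X11b.isElliptic_of_discOf_ne_zero 0 (-1) 1 (-62) 230 (by decide +kernel)
  haveI hM : (⟨0, -1, 1, -3075605144, -65650380044998⟩ : WeierstrassCurve ℚ).IsGloballyMinimal :=
    isGloballyMinimal_of_krausCriterion_bounded 0 (-1) 1 (-3075605144) (-65650380044998)
      (by decide +kernel) (by decide +kernel) (by decide +kernel)
  haveI : Fact (Nat.Prime 3) := ⟨by norm_num⟩
  have hρ : Surj (⟨0, -1, 1, -3075605144, -65650380044998⟩ : WeierstrassCurve ℚ) 3 :=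
    surj3_v104907e1 (integralModelInt_eq_of_map_eq _ (map_mk_int 0 (-1) 1 (-3075605144) (-65650380044998)))
  haveI hM' : (⟨0, -1, 1, -62, 230⟩ : WeierstrassCurve ℚ).IsGloballyMinimal :=
    isGloballyMinimal_of_krausCriterion_bounded 0 (-1) 1 (-62) 230
      (by decide +kernel) (by decide +kernel) (by decide +kernel)
  have hI' : integralModelInt (⟨0, -1, 1, -62, 230⟩ : WeierstrassCurve ℚ) = (⟨0, -1, 1, -62, 230⟩ : WeierstrassCurve ℤ) :=
    integralModelInt_eq_of_map_eq _ (map_mk_int 0 (-1) 1 (-62) 230)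
  have hmult' : Mult (⟨0, -1, 1, -62, 230⟩ : WeierstrassCurve ℚ) 3 :=
    hasMultiplicativeReductionAtPrime_of_intModel hI' 3 (by rw [intCurve_Δ]; decide +kernel)
      (by rw [intCurve_c₄]; decide +kernel)
  have hj' : ¬ ((3 : ℕ) : ℤ) ∣ padicValRat 3 (⟨0, -1, 1, -62, 230⟩ : WeierstrassCurve ℚ).j := by
    rw [← AdditivePotMult.dvd_padicValInt_minimalDiscriminantInt_iff_of_mult _ 3 hmult' 3,
      minimalDiscriminantInt_eq hI', padicValInt_eq_of_dvd_of_not_dvd 3 (e := 2)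
        (by rw [intCurve_Δ]; decide +kernel) (by rw [intCurve_Δ]; decide +kernel)]
    decide
  exact X11b.bsdp_of_kolyvagin_of_congr_of_primeList_of_mult _ 3 hCT hGZK hKo hB hK hH hP hnt (by norm_num) hρ hI
    hr hs hv _ θ hθ hrank (map_mk_int 0 (-1) 1 (-3075605144) (-65650380044998)) (map_mk_int 0 (-1) 1 (-62) 230)
    [3, 11, 17] (by decide)
    (X11b.forall_mem_of_natAbs_eq_prod_pow [3, 11, 17] [4, 9, 10] (by intro q hq; fin_cases hq <;> norm_num)
      (by rw [intCurve_Δ]; decide +kernel))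
    (X11b.forall_mem_of_natAbs_eq_prod_pow [3, 11, 17] [2, 3, 2] (by intro q hq; fin_cases hq <;> norm_num)
      (by rw [intCurve_Δ]; decide +kernel))
    hmult' hj' hloc


/-- **`134832t1 @ 3` — the visibility certificate of `bsdp_v134832t1` (gen 6) with the local binder at
`v = 3` PROVED**: `hloc` is asked only at the primes of `S` other than `3`; at `3` the partner
`134832m1` has multiplicative reduction with `ord_3 Δ_min = 2` (`3 ∤ 2`), so `E'(ℚ_3)[3] = 0`
is the kernel theorem `natCard_ker_nsmul_adicCompletion_eq_one_of_mult_of_not_dvd_padicValRat_j`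
(gen 8; partner globally minimal by the bounded Kraus criterion with the `c₆ = 2⁶L`, `L ≡ 1 (4)` pattern at `2`,
multiplicative at `3` from `3 ∣ Δ`, `3 ∤ c₄`). All other binders and their two-engine evidence exactly as in `bsdp_v134832t1`.
Per pair; nothing booked. [cite: McCallumLMS1991, §1 Theorem (Kolyvagin), p. 296]
[cite: CremonaMazur2000, §3 and Table 1] [cite: SerreInventiones1972, §1.12 (Cor. of Prop. 13)] -/
theorem bsdp_v134832t1_of_mult (hCT : exists_casselsTate_pairing (K := ℚ))
    (hGZK : rank_eq_analyticRank_of_analyticRank_le_one)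
    (W : WeierstrassCurve ℚ) (hW : W = ⟨0, -1, 0, -6203208, 15088082928⟩)
    {N : ℕ} [NeZero N] {K : Type} [Field K] [NumberField K] (hKo : kolyvagin N W K)
    (hB : Kolyvagin1990_padicValNat_card_sha_le N W K) (hK : IsImaginaryQuadratic K)
    (hH : SatisfiesHeegnerHypothesis N K) {P : (W.baseChange K).toAffine.Point}
    (hP : IsHeegnerPoint N W K P) (hnt : ¬ IsOfFinAddOrder P)
    (hI : padicValNat 3 (AddSubgroup.zmultiples P).index ≤ 1)
    (hr : W.analyticRank = 1) {s : ℚ} (hs : shaAn W = (s : ℂ)) (hv : padicValRat 3 s = 2)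
    (W' : WeierstrassCurve ℚ) (hW' : W' = ⟨0, -1, 0, -2632, 53104⟩)
    (θ : geomTorsion W' (3 : ℕ) ≃+ geomTorsion W (3 : ℕ))
    (hθ : ∀ (σ : Field.absoluteGaloisGroup ℚ) (Q : geomTorsion W' (3 : ℕ)), θ (σ • Q) = σ • θ Q)
    (hrank : 3 ≤ W'.mordellWeilRank)
    (hloc : ∀ v : HeightOneSpectrum (𝓞 ℚ), (Rat.HeightOneSpectrum.primesEquiv v : ℕ) ∈ [2, 3, 53] →
      (Rat.HeightOneSpectrum.primesEquiv v : ℕ) ≠ 3 →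
      Nat.card (nsmulAddMonoidHom 3 :
        (W'.baseChange (v.adicCompletion ℚ)).toAffine.Point →+ _).ker = 1) :
    BSDp W 3 := by
  subst hW hW'
  haveI hE : (⟨0, -1, 0, -6203208, 15088082928⟩ : WeierstrassCurve ℚ).IsElliptic :=
    X11b.isElliptic_of_discOf_ne_zero 0 (-1) 0 (-6203208) 15088082928 (by decide +kernel)
  haveI hE' : (⟨0, -1, 0, -2632, 53104⟩ : WeierstrassCurve ℚ).IsElliptic :=
    X11b.isElliptic_of_discOf_ne_zero 0 (-1) 0 (-2632) 53104 (by decide +kernel)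
  haveI hM : (⟨0, -1, 0, -6203208, 15088082928⟩ : WeierstrassCurve ℚ).IsGloballyMinimal :=
    X11b.isGloballyMinimal_v134832t1
  haveI : Fact (Nat.Prime 3) := ⟨by norm_num⟩
  have hρ : Surj (⟨0, -1, 0, -6203208, 15088082928⟩ : WeierstrassCurve ℚ) 3 :=
    surj3_v134832t1 (integralModelInt_eq_of_map_eq _ (map_mk_int 0 (-1) 0 (-6203208) 15088082928))
  haveI hM' : (⟨0, -1, 0, -2632, 53104⟩ : WeierstrassCurve ℚ).IsGloballyMinimal :=
    X11b.isGloballyMinimal_of_krausCriterion_bounded₃ 0 (-1) 0 (-2632) 53104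
      (by decide +kernel) (by decide +kernel) (by decide +kernel)
  have hI' : integralModelInt (⟨0, -1, 0, -2632, 53104⟩ : WeierstrassCurve ℚ) = (⟨0, -1, 0, -2632, 53104⟩ : WeierstrassCurve ℤ) :=
    integralModelInt_eq_of_map_eq _ (map_mk_int 0 (-1) 0 (-2632) 53104)
  have hmult' : Mult (⟨0, -1, 0, -2632, 53104⟩ : WeierstrassCurve ℚ) 3 :=
    hasMultiplicativeReductionAtPrime_of_intModel hI' 3 (by rw [intCurve_Δ]; decide +kernel)
      (by rw [intCurve_c₄]; decide +kernel)
  have hj' : ¬ ((3 : ℕ) : ℤ) ∣ padicValRat 3 (⟨0, -1, 0, -2632, 53104⟩ : WeierstrassCurve ℚ).j := by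
    rw [← AdditivePotMult.dvd_padicValInt_minimalDiscriminantInt_iff_of_mult _ 3 hmult' 3,
      minimalDiscriminantInt_eq hI', padicValInt_eq_of_dvd_of_not_dvd 3 (e := 2)
        (by rw [intCurve_Δ]; decide +kernel) (by rw [intCurve_Δ]; decide +kernel)]
    decide
  exact X11b.bsdp_of_kolyvagin_of_congr_of_primeList_of_mult _ 3 hCT hGZK hKo hB hK hH hP hnt (by norm_num) hρ hI
    hr hs hv _ θ hθ hrank (map_mk_int 0 (-1) 0 (-6203208) 15088082928) (map_mk_int 0 (-1) 0 (-2632) 53104)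
    [2, 3, 53] (by decide)
    (X11b.forall_mem_of_natAbs_eq_prod_pow [2, 3, 53] [23, 1, 9] (by intro q hq; fin_cases hq <;> norm_num)
      (by rw [intCurve_Δ]; decide +kernel))
    (X11b.forall_mem_of_natAbs_eq_prod_pow [2, 3, 53] [13, 2, 3] (by intro q hq; fin_cases hq <;> norm_num)
      (by rw [intCurve_Δ]; decide +kernel))
    hmult' hj' hloc


/-- **`161376m1 @ 3` — the visibility certificate of `bsdp_v161376m1` (gen 6) with the local binder at
`v = 3` PROVED**: `hloc` is asked only at the primes of `S` other than `3`; at `3` the partner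
`161376a1` has multiplicative reduction with `ord_3 Δ_min = 7` (`3 ∤ 7`), so `E'(ℚ_3)[3] = 0`
is the kernel theorem `natCard_ker_nsmul_adicCompletion_eq_one_of_mult_of_not_dvd_padicValRat_j`
(gen 8; partner globally minimal by the bounded Kraus criterion, multiplicative at `3` from
`3 ∣ Δ`, `3 ∤ c₄`). All other binders and their two-engine evidence exactly as in `bsdp_v161376m1`.
Per pair; nothing booked. [cite: McCallumLMS1991, §1 Theorem (Kolyvagin), p. 296]
[cite: CremonaMazur2000, §3 and Table 1] [cite: SerreInventiones1972, §1.12 (Cor. of Prop. 13)] -/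
theorem bsdp_v161376m1_of_mult (hCT : exists_casselsTate_pairing (K := ℚ))
    (hGZK : rank_eq_analyticRank_of_analyticRank_le_one)
    (W : WeierstrassCurve ℚ) (hW : W = ⟨0, 1, 0, -205642, -35958520⟩)
    {N : ℕ} [NeZero N] {K : Type} [Field K] [NumberField K] (hKo : kolyvagin N W K)
    (hB : Kolyvagin1990_padicValNat_card_sha_le N W K) (hK : IsImaginaryQuadratic K)
    (hH : SatisfiesHeegnerHypothesis N K) {P : (W.baseChange K).toAffine.Point}
    (hP : IsHeegnerPoint N W K P) (hnt : ¬ IsOfFinAddOrder P)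
    (hI : padicValNat 3 (AddSubgroup.zmultiples P).index ≤ 1)
    (hr : W.analyticRank = 1) {s : ℚ} (hs : shaAn W = (s : ℂ)) (hv : padicValRat 3 s = 2)
    (W' : WeierstrassCurve ℚ) (hW' : W' = ⟨0, 1, 0, -1585, 23039⟩)
    (θ : geomTorsion W' (3 : ℕ) ≃+ geomTorsion W (3 : ℕ))
    (hθ : ∀ (σ : Field.absoluteGaloisGroup ℚ) (Q : geomTorsion W' (3 : ℕ)), θ (σ • Q) = σ • θ Q)
    (hrank : 3 ≤ W'.mordellWeilRank)
    (hloc : ∀ v : HeightOneSpectrum (𝓞 ℚ), (Rat.HeightOneSpectrum.primesEquiv v : ℕ) ∈ [2, 3, 41] →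
      (Rat.HeightOneSpectrum.primesEquiv v : ℕ) ≠ 3 →
      Nat.card (nsmulAddMonoidHom 3 :
        (W'.baseChange (v.adicCompletion ℚ)).toAffine.Point →+ _).ker = 1) :
    BSDp W 3 := by
  subst hW hW'
  haveI hE : (⟨0, 1, 0, -205642, -35958520⟩ : WeierstrassCurve ℚ).IsElliptic :=
    X11b.isElliptic_of_discOf_ne_zero 0 1 0 (-205642) (-35958520) (by decide +kernel)
  haveI hE' : (⟨0, 1, 0, -1585, 23039⟩ : WeierstrassCurve ℚ).IsElliptic :=
    X11b.isElliptic_of_discOf_ne_zero 0 1 0 (-1585) 23039 (by decide +kernel)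
  haveI hM : (⟨0, 1, 0, -205642, -35958520⟩ : WeierstrassCurve ℚ).IsGloballyMinimal :=
    isGloballyMinimal_of_krausCriterion_bounded 0 1 0 (-205642) (-35958520)
      (by decide +kernel) (by decide +kernel) (by decide +kernel)
  haveI : Fact (Nat.Prime 3) := ⟨by norm_num⟩
  have hρ : Surj (⟨0, 1, 0, -205642, -35958520⟩ : WeierstrassCurve ℚ) 3 :=
    surj3_v161376m1 (integralModelInt_eq_of_map_eq _ (map_mk_int 0 1 0 (-205642) (-35958520)))
  haveI hM' : (⟨0, 1, 0, -1585, 23039⟩ : WeierstrassCurve ℚ).IsGloballyMinimal :=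
    isGloballyMinimal_of_krausCriterion_bounded 0 1 0 (-1585) 23039
      (by decide +kernel) (by decide +kernel) (by decide +kernel)
  have hI' : integralModelInt (⟨0, 1, 0, -1585, 23039⟩ : WeierstrassCurve ℚ) = (⟨0, 1, 0, -1585, 23039⟩ : WeierstrassCurve ℤ) :=
    integralModelInt_eq_of_map_eq _ (map_mk_int 0 1 0 (-1585) 23039)
  have hmult' : Mult (⟨0, 1, 0, -1585, 23039⟩ : WeierstrassCurve ℚ) 3 :=
    hasMultiplicativeReductionAtPrime_of_intModel hI' 3 (by rw [intCurve_Δ]; decide +kernel)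
      (by rw [intCurve_c₄]; decide +kernel)
  have hj' : ¬ ((3 : ℕ) : ℤ) ∣ padicValRat 3 (⟨0, 1, 0, -1585, 23039⟩ : WeierstrassCurve ℚ).j := by
    rw [← AdditivePotMult.dvd_padicValInt_minimalDiscriminantInt_iff_of_mult _ 3 hmult' 3,
      minimalDiscriminantInt_eq hI', padicValInt_eq_of_dvd_of_not_dvd 3 (e := 7)
        (by rw [intCurve_Δ]; decide +kernel) (by rw [intCurve_Δ]; decide +kernel)]
    decide
  exact X11b.bsdp_of_kolyvagin_of_congr_of_primeList_of_mult _ 3 hCT hGZK hKo hB hK hH hP hnt (by norm_num) hρ hI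
    hr hs hv _ θ hθ hrank (map_mk_int 0 1 0 (-205642) (-35958520)) (map_mk_int 0 1 0 (-1585) 23039)
    [2, 3, 41] (by decide)
    (X11b.forall_mem_of_natAbs_eq_prod_pow [2, 3, 41] [6, 2, 7] (by intro q hq; fin_cases hq <;> norm_num)
      (by rw [intCurve_Δ]; decide +kernel))
    (X11b.forall_mem_of_natAbs_eq_prod_pow [2, 3, 41] [12, 7, 2] (by intro q hq; fin_cases hq <;> norm_num)
      (by rw [intCurve_Δ]; decide +kernel))
    hmult' hj' hloc


end Summit.BirchSwinnertonDyer.Rank1Residual.Visibility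

end
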